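import Literature.Analysis.FluidPDE.LeiZhang2011Proofs
import Literature.Analysis.FluidPDE.IntegratedChainRule
import HarnessLib

/-!
# Lei–Zhang 2011, §2: the energy identity for the swirl equation in time-integrated form

Analysis/FluidPDE proofs file (theorems only), on the discharge path of the named fact
`Literature.Analysis.FluidPDE.LeiZhang2011_liouville` (Z. Lei, Q. S. Zhang, J. Funct. Anal. 261
(2011) = arXiv:1011.5066, Theorem 1.2; step 1 of its printed proof is Theorem 1.1 of the paper,
whose §2 starts from the energy identity (2.2)–(2.3) obtained by testing the equation
(1.5) `∂ₜΓ + b·∇Γ + (2/r)∂ᵣΓ = ΔΓ` with `q|Γ|^{2q−2}Γ ψ_R²`).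

In the tree the equation is available only in **time-integrated form** off the axis
(`KNSS2009_regularity_axisymmetric_swirl`: `Γ(t,x) − Γ(s,x) = ∫ₛᵗ (ΔΓ − DΓ[b] − (2/r)∂ᵣΓ) dτ`
for `r(x) ≠ 0`), with a drift `b` that is a curl, `b = curl B` a.e., of a differentiable `BMO`
field (the tree form of "the stream function is BMO"). This file assembles, for a general
`H ∈ C²` with `H(0) = 0` (the paper: `H(v) = |v|^{2q}`), an axisymmetric cut-off `φ ∈ C²_c` and
a time factor `η ∈ C¹`, the identity

`∫ (H(Γ(t₂)) η(t₂) − H(Γ(t₁)) η(t₁)) φ² dx = ∫_{t₁}^{t₂} ( η [ −∫ H''(Γ)|∇Γ|²φ² − ∫ H'(Γ)∇Γ·∇φ²`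
`  + ∫ H(Γ) b·∇φ² + ∫ (2/r) H(Γ) ∂ᵣφ² ] + η' ∫ H(Γ) φ² ) ds`

(`LeiZhang2011.energy_identity`) from the integrated chain rule in time
(`integral_comp_mul_sub_eq_integral_integral_ae`) and the three slice identities of
`LeiZhang2011Proofs` (viscous term by Green's identity, transport term by the weak
divergence-freeness of a curl, axis term by the integration by parts in `r` using `Γ = 0` on
the axis). This is (2.2)–(2.3) of the paper before any estimate, with the transport term kept
in the form `∫ H(Γ) b·∇φ²` (to be estimated through the stream function,
`integral_mul_inner_gradient_eq_integral_inner_sub_cross`, and John–Nirenberg).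

## References

* Z. Lei, Q. S. Zhang, J. Funct. Anal. 261 (2011) 2323–2345 = arXiv:1011.5066, §2 (2.2)–(2.3),
  p. 6. [LeiZhang2011]
-/

noncomputable section

open MeasureTheory Set Function Filter Metric intervalIntegral
open _root_.Topology
open scoped InnerProductSpace RealInnerProductSpace NNReal ENNReal Laplacian

namespace Literature.Analysis.FluidPDE

namespace LeiZhang2011

/-- **The energy identity (Lei–Zhang 2011, (2.2)–(2.3)) for the swirl equation in
time-integrated form.** Let, for `s ∈ [t₁, t₂]`, `F(s, ·) ∈ C²(ℝ³)` be axisymmetric scalars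
vanishing on the axis, `b(s, ·)` locally integrable drifts with `b(s, ·) = curl B(s, ·)` a.e.
for a differentiable `B(s, ·)`, for a.e. `s`, and suppose the equation holds in time-integrated
form for a.e. `x`: `F(s, x) = F(t₁, x) + ∫_{t₁}^s N(τ, x) dτ` with
`N = ΔF − DF[b] − (2/r) ∂ᵣF`. Then for `H ∈ C²` with `H(0) = 0`, an axisymmetric cut-off
`φ ∈ C²_c` and `η ∈ C¹`, provided the space–time integrand `(H'(F) N η + H(F) η') φ²` is
integrable on `(t₁, t₂] × ℝ³`,
`∫ (H(F(t₂)) η(t₂) − H(F(t₁)) η(t₁)) φ² = ∫_{t₁}^{t₂} (η(s) [−∫ (H''(F)‖∇F‖²φ² + H'(F)⟪∇F, ∇φ²⟫)`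
`+ ∫ H(F)⟪b, ∇φ²⟫ + ∫ (2/r) H(F) ∂ᵣ(φ²)] + η'(s) ∫ H(F) φ²) ds`. [cite: LeiZhang2011, §2 (2.2)–(2.3) (arXiv:1011.5066 p. 6)] -/
theorem energy_identity {F N : ℝ → EuclideanSpace ℝ (Fin 3) → ℝ}
    {b Bst : ℝ → EuclideanSpace ℝ (Fin 3) → EuclideanSpace ℝ (Fin 3)} {t₁ t₂ : ℝ} (ht : t₁ ≤ t₂)
    (hF2 : ∀ s, ContDiff ℝ 2 (F s)) (hFa : ∀ s, IsAxisymmetricScalar (F s))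
    (hF0 : ∀ s x, cylRadius x = 0 → F s x = 0)
    (hb : ∀ s, LocallyIntegrable (b s) volume)
    (hBst : ∀ᵐ s ∂(volume.restrict (Ioc t₁ t₂)),
      Differentiable ℝ (Bst s) ∧ curl (Bst s) =ᵐ[volume] b s)
    (hN : ∀ s x, N s x =
      (Δ (F s)) x - fderiv ℝ (F s) x (b s x) - 2 / cylRadius x * fderiv ℝ (F s) x (eR x))
    (heq : ∀ᵐ x ∂(volume : Measure (EuclideanSpace ℝ (Fin 3))),
      IntervalIntegrable (fun s => N s x) volume t₁ t₂ ∧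
        ∀ s ∈ Icc t₁ t₂, F s x = F t₁ x + ∫ τ in t₁..s, N τ x)
    {H : ℝ → ℝ} (hH : ContDiff ℝ 2 H) (hH0 : H 0 = 0)
    {φ : EuclideanSpace ℝ (Fin 3) → ℝ} (hφ : ContDiff ℝ 2 φ) (hφc : HasCompactSupport φ)
    (hφa : IsAxisymmetricScalar φ) {η : ℝ → ℝ} (hη : ContDiff ℝ 1 η)
    (hint : Integrable (fun p : ℝ × EuclideanSpace ℝ (Fin 3) =>
      (deriv H (F p.1 p.2) * N p.1 p.2 * η p.1 + H (F p.1 p.2) * deriv η p.1) * φ p.2 ^ 2)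
      ((volume.restrict (Ioc t₁ t₂)).prod volume)) :
    ∫ x, (H (F t₂ x) * η t₂ - H (F t₁ x) * η t₁) * φ x ^ 2 =
      ∫ s in t₁..t₂, (η s *
        (-(∫ x, (deriv (deriv H) (F s x) * ‖gradient (F s) x‖ ^ 2 * φ x ^ 2 +
            deriv H (F s x) * ⟪gradient (F s) x, gradient (fun y => φ y ^ 2) x⟫)) +
          (∫ x, H (F s x) * ⟪b s x, gradient (fun y => φ y ^ 2) x⟫) +
          ∫ x, 2 / cylRadius x * (H (F s x) * fderiv ℝ (fun y => φ y ^ 2) x (eR x))) +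
        deriv η s * ∫ x, H (F s x) * φ x ^ 2) := by
  -- Step 1: the integrated chain rule in time, under `∫ … φ² dx`
  have h1 := integral_comp_mul_sub_eq_integral_integral_ae (μ := volume) ht heq
    (hH.of_le one_le_two) hη (fun x => φ x ^ 2) hint
  rw [h1]
  -- Step 2: the slice identities, for a.e. `s ∈ (t₁, t₂]`
  have hH1 : ContDiff ℝ 1 H := hH.of_le one_le_two
  have hH' : ContDiff ℝ 1 (deriv H) := by
    have h2 : ContDiff ℝ (1 + 1) H := by rw [one_add_one_eq_two]; exact hH
    exact h2.deriv'
  have hφ1 : ContDiff ℝ 1 φ := hφ.of_le one_le_two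
  have hφ2c : HasCompactSupport fun y => φ y ^ 2 :=
    hφc.comp_left (g := fun t : ℝ => t ^ 2) (by simp)
  -- integrability of the slices of the space–time integrand
  have hslice : ∀ᵐ s ∂(volume.restrict (Ioc t₁ t₂)), Integrable (fun x =>
      (deriv H (F s x) * N s x * η s + H (F s x) * deriv η s) * φ x ^ 2)
      (volume : Measure (EuclideanSpace ℝ (Fin 3))) :=
    hint.prod_right_ae
  have hae : ∀ᵐ s ∂(volume.restrict (Ioc t₁ t₂)),
      ∫ x, (deriv H (F s x) * N s x * η s + H (F s x) * deriv η s) * φ x ^ 2 =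
        η s * (-(∫ x, (deriv (deriv H) (F s x) * ‖gradient (F s) x‖ ^ 2 * φ x ^ 2 +
            deriv H (F s x) * ⟪gradient (F s) x, gradient (fun y => φ y ^ 2) x⟫)) +
          (∫ x, H (F s x) * ⟪b s x, gradient (fun y => φ y ^ 2) x⟫) +
          ∫ x, 2 / cylRadius x * (H (F s x) * fderiv ℝ (fun y => φ y ^ 2) x (eR x))) +
        deriv η s * ∫ x, H (F s x) * φ x ^ 2 := by
    filter_upwards [hBst, hslice] with s hBs hsl
    obtain ⟨hBd, hBcurl⟩ := hBs
    -- the three pieces of `∫ H'(F) N φ²` and their integrability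
    set P₁ : EuclideanSpace ℝ (Fin 3) → ℝ := fun x => deriv H (F s x) * φ x ^ 2 * (Δ (F s)) x
      with hP₁
    set P₂ : EuclideanSpace ℝ (Fin 3) → ℝ := fun x =>
      ⟪b s x, gradient (F s) x⟫ * (deriv H (F s x) * φ x ^ 2) with hP₂
    set P₃ : EuclideanSpace ℝ (Fin 3) → ℝ := fun x =>
      2 / cylRadius x * (fderiv ℝ (F s) x (eR x) * (deriv H (F s x) * φ x ^ 2)) with hP₃
    set P₄ : EuclideanSpace ℝ (Fin 3) → ℝ := fun x => H (F s x) * φ x ^ 2 with hP₄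
    have hHF : Continuous fun x => deriv H (F s x) :=
      (hH.continuous_deriv (by norm_num)).comp (hF2 s).continuous
    have hσc : Continuous fun x => deriv H (F s x) * φ x ^ 2 := hHF.mul (hφ.continuous.pow 2)
    have hσcs : HasCompactSupport fun x => deriv H (F s x) * φ x ^ 2 := hφ2c.mul_left
    -- `P₁` : continuous with compact support
    have hΔc : Continuous (Δ (F s)) := by
      have h2 : ContDiff ℝ ((0 : ℕ∞) + 2 : ℕ∞) (F s) := by simpa using hF2 s
      exact (contDiff_laplacian (n := 0) h2).continuous
    have hiP₁ : Integrable P₁ (volume : Measure (EuclideanSpace ℝ (Fin 3))) :=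
      (hσc.mul hΔc).integrable_of_hasCompactSupport hσcs.mul_right
    -- `P₂` : locally integrable drift against a continuous compactly supported field
    have hgradF : Continuous (gradient (F s)) := continuous_gradient_of_contDiff ((hF2 s).of_le one_le_two)
    have hW : Continuous fun x => (deriv H (F s x) * φ x ^ 2) • gradient (F s) x := hσc.smul hgradF
    have hWcs : HasCompactSupport fun x => (deriv H (F s x) * φ x ^ 2) • gradient (F s) x :=
      hσcs.smul_right
    have hiP₂ : Integrable P₂ (volume : Measure (EuclideanSpace ℝ (Fin 3))) := by
      have h := integrable_inner_of_locallyIntegrable (hb s) hW hWcs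
      refine h.congr (Eventually.of_forall fun x => ?_)
      simp only [hP₂, inner_smul_right]
      ring
    -- `P₃` : the axis term
    have hHFs1 : ContDiff ℝ 1 fun x => H (F s x) := hH1.comp ((hF2 s).of_le one_le_two)
    have hHFa : IsAxisymmetricScalar fun x => H (F s x) := fun θ x => by simp only [hFa s θ x]
    have hHF0 : ∀ x, cylRadius x = 0 → H (F s x) = 0 := fun x hx => by rw [hF0 s x hx, hH0]
    have hφ2C : ContDiff ℝ 1 fun y => φ y ^ 2 := hφ1.pow 2
    have hφ2a : IsAxisymmetricScalar fun y => φ y ^ 2 := fun θ x => by simp only [hφa θ x]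
    have hiP₃ : Integrable P₃ (volume : Measure (EuclideanSpace ℝ (Fin 3))) := by
      have h := integrable_two_div_cylRadius_mul_fderiv_eR_mul hHFs1 hφ2C hφ2c hHFa hφ2a hHF0
      refine h.congr (Eventually.of_forall fun x => ?_)
      have hd : fderiv ℝ (fun y => H (F s y)) x = deriv H (F s x) • fderiv ℝ (F s) x :=
        ((((hH.differentiable two_ne_zero) (F s x)).hasDerivAt).comp_hasFDerivAt x
          (((hF2 s).differentiable two_ne_zero) x).hasFDerivAt).fderiv
      simp only [hP₃, hd, FunLike.coe_smul, Pi.smul_apply, smul_eq_mul]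
      ring
    -- `P₄`
    have hiP₄ : Integrable P₄ (volume : Measure (EuclideanSpace ℝ (Fin 3))) :=
      ((hH.continuous.comp (hF2 s).continuous).mul (hφ.continuous.pow 2)).integrable_of_hasCompactSupport
        hφ2c.mul_left
    -- pointwise: the integrand is `η s (P₁ − P₂ − P₃) + η' s P₄`
    have hpt : ∀ x, (deriv H (F s x) * N s x * η s + H (F s x) * deriv η s) * φ x ^ 2 =
        η s * (P₁ x - P₂ x - P₃ x) + deriv η s * P₄ x := by
      intro x
      simp only [hP₁, hP₂, hP₃, hP₄, hN s x, ← inner_gradient_left (F s) x (b s x),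
        real_inner_comm (b s x)]
      ring
    simp_rw [hpt]
    rw [integral_add (((hiP₁.sub' hiP₂).sub' hiP₃).const_mul (η s)) (hiP₄.const_mul (deriv η s)),
      MeasureTheory.integral_const_mul, MeasureTheory.integral_const_mul,
      integral_sub (hiP₁.sub' hiP₂) hiP₃,
      integral_sub hiP₁ hiP₂]
    -- the slice identities
    have e₁ : ∫ x, P₁ x = -∫ x, (deriv (deriv H) (F s x) * ‖gradient (F s) x‖ ^ 2 * φ x ^ 2 +
        deriv H (F s x) * ⟪gradient (F s) x, gradient (fun y => φ y ^ 2) x⟫) :=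
      integral_laplacian_mul_deriv_comp_mul_sq (hF2 s) hH hφ1 hφc
    have e₂ : ∫ x, P₂ x = -∫ x, H (F s x) * ⟪b s x, gradient (fun y => φ y ^ 2) x⟫ :=
      integral_inner_gradient_mul_deriv_comp_mul_sq hBd hBcurl (hb s) (hF2 s) hH hφ hφc
    have e₃ : ∫ x, P₃ x = -∫ x, 2 / cylRadius x * (H (F s x) * fderiv ℝ (fun y => φ y ^ 2) x (eR x)) :=
      integral_two_div_cylRadius_mul_fderiv_eR_mul_deriv_comp_mul_sq ((hF2 s).of_le one_le_two)
        (hFa s) (hF0 s) hH1 hH0 hφ1 hφc hφa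
    rw [e₁, e₂, e₃]
    ring
  -- Step 3: replace the inner integrals for a.e. `s`
  refine intervalIntegral.integral_congr_ae ?_
  rw [uIoc_of_le ht]
  exact (ae_restrict_iff' measurableSet_Ioc).1 hae

end LeiZhang2011

end Literature.Analysis.FluidPDE
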